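import Summits.QuantumFields.QCD.Theses.SpectralDefectExtinction
import Literature.MathematicalPhysics.QuantumFieldTheory.QCDPhaseQuenched
import Literature.MathematicalPhysics.QuantumFieldTheory.WilsonEnergyConvexity
import Literature.MathematicalPhysics.QuantumLattice.WilsonDiracAP
import Literature.MathematicalPhysics.QuantumLattice.TorusWilsonGibbs
import Literature.Barriers.QuantumFields.WilsonDeterminantSign

/-!
# Stub `stub_honestExpectAP_eq_haarRatio` of line `block-away-the-sign` (G2b, measure bookkeeping)
(crux `Summit.QuantumFields.QCD.Theses.SpectralDefectExtinction.ExtinctionBuildsQCD`, item stmt-QuantumFields-18064)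

The honest all-antiperiodic functional of the line, written with the normalised Wilson measure
`μ_W = wilsonMeasure (fundamentalRep (Fin 3)) β_k`,
`E(h) = ∫ h · Re ∏_f det D_W^{AP}(U, m_f(k)) dμ_W / ∫ Re ∏_f det D_W^{AP}(U, m_f(k)) dμ_W`,
equals the Haar-ratio functional of the sea weight `w_{k,S}(U) = e^{−β_k S_W(U)} Re ∏_f det D_W^{AP}(U, m_f(k))`
consumed by the node `RobustYangMillsRG`,
`E'(h) = ∫ h w dU / ∫ w dU` with `dU = Measure.pi fun _ : Edge 4 (2S+1) => haarProbability SU3`.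

Proof (pure bookkeeping, Montvay–Münster §5.1; Seiler LNP 159 Ch. 1).  `μ_W = Z⁻¹ e^{−β S_W} dU` with
`0 < Z = ∫ e^{−β S_W} dU < ∞` for the continuous fundamental representation, so for EVERY real observable `X`
(no integrability needed, both sides carry the same Bochner junk value)
`∫ X dμ_W = ∫ X e^{−β S_W} dU / Z` (tree: `wilsonExpectation_eq_integral_div`,
`Literature/MathematicalPhysics/QuantumFieldTheory/WilsonEnergyConvexity.lean`), and `Z` cancels in the ratio
(`div_div_div_cancel_right₀`, `integral_exp_neg_mul_wilsonAction_pos`).  The only remaining step is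
`e^{−β·x} = e^{−(β x)}` (`neg_mul`) and commuting the factors of the integrands.
-/

noncomputable section

namespace Summit.QuantumFields.QCD.Cruxes.ExtinctionBuildsQCD.BlockAwayTheSign

open scoped BigOperators Topology Classical MeasureTheory Matrix
open Filter MeasureTheory Matrix
open Literature.MathematicalPhysics.QuantumLattice Literature.MathematicalPhysics.AQFT
  Literature.MathematicalPhysics.QuantumFieldTheory Literature.Probability.LatticeModels
open Literature.Barriers.QuantumFields.WilsonDeterminant
open Summit.QuantumFields.QCD.Theses.SpectralDefectExtinction
open Summit.QuantumFields.QCD.Theses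

/-- **Ratios of Wilson expectations are ratios of weighted product-Haar integrals.** For a compact gauge
group `G`, a continuous matrix representation `ρ`, and ANY two real observables `f, g` on the configurations of
the torus `(ℤ/Lℤ)^d`:
`∫ f dμ_{Λ,β} / ∫ g dμ_{Λ,β} = ∫ e^{−β S_W} f dU / ∫ e^{−β S_W} g dU` (`dU` = product Haar measure), because
`∫ X dμ_{Λ,β} = ∫ X e^{−β S_W} dU / Z` with `Z = ∫ e^{−β S_W} dU > 0` and `Z` cancels. No integrability
hypotheses: a non-integrable observable gives the Bochner junk value `0` on both sides. [folklore] -/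
theorem haarRatio_integral_div_integral_wilsonMeasure {d L N : ℕ} [NeZero L] {G : Type*} [Group G]
    [TopologicalSpace G] [IsTopologicalGroup G] [CompactSpace G] [MeasurableSpace G] [BorelSpace G]
    (ρ : G →* Matrix (Fin N) (Fin N) ℂ) (hρ : Continuous ρ) (β : ℝ) (f g : GaugeConfig d L G → ℝ) :
    (∫ U, f U ∂(wilsonMeasure ρ β)) / (∫ U, g U ∂(wilsonMeasure ρ β)) =
      (∫ U, Real.exp (-(β * wilsonAction ρ U)) * f U
          ∂(Measure.pi fun _ : Edge d L => haarProbability G)) /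
        ∫ U, Real.exp (-(β * wilsonAction ρ U)) * g U
          ∂(Measure.pi fun _ : Edge d L => haarProbability G) := by
  have hf := wilsonExpectation_eq_integral_div (d := d) (L := L) ρ hρ β f
  have hg := wilsonExpectation_eq_integral_div (d := d) (L := L) ρ hρ β g
  unfold wilsonExpectation at hf hg
  rw [hf, hg, div_div_div_cancel_right₀ (integral_exp_neg_mul_wilsonAction_pos ρ hρ β).ne']
  simp only [neg_mul, mul_comm (Real.exp _)]

/-- **Stub G2b (`stub_honestExpectAP_eq_haarRatio`) — MEASURE BOOKKEEPING.** The honest all-antiperiodic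
functional written with the Wilson measure equals the node's Haar-ratio functional of the sea weight:
`∫ h Re∏det^{AP} dμ_W / ∫ Re∏det^{AP} dμ_W = ∫ h e^{−β_k S_W} Re∏det^{AP} dU / ∫ e^{−β_k S_W} Re∏det^{AP} dU`, because
`μ_W = Z⁻¹ · e^{−β S_W} · ∏ dU_e` (`wilsonMeasure`, `wilsonWeight`) with `0 < Z < ∞` for the continuous fundamental
representation of `SU(3)`, and the factor `Z⁻¹` cancels in the ratio (no integrability hypotheses needed: both sides
carry the same Bochner junk).  Instance of `haarRatio_integral_div_integral_wilsonMeasure` with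
`f = h · Re∏det^{AP}`, `g = Re∏det^{AP}` (Montvay–Münster 1994 §5.1, the effective gauge measure with the fermion
determinant; Seiler LNP 159 Ch. 1). [cite: MontvayMunster1994, §5.1] -/
theorem stub_honestExpectAP_eq_haarRatio : ∀ {Nf : ℕ} (reg : QCDRegularisation Nf) (m : Fin Nf → ℝ) (k S : ℕ) (h : GaugeConfig 4 (2 * S + 1) SU3 → ℝ), (∫ (U : GaugeConfig 4 (2 * S + 1) SU3), h U * (∏ fl : Fin Nf, fermionDet (Literature.MathematicalPhysics.QuantumLattice.wilsonDiracAP U (reg.mcrit k + reg.a k * m fl / reg.Zm k))).re ∂(wilsonMeasure (fundamentalRep (Fin 3)) (reg.β k))) / (∫ (U : GaugeConfig 4 (2 * S + 1) SU3), (∏ fl : Fin Nf, fermionDet (Literature.MathematicalPhysics.QuantumLattice.wilsonDiracAP U (reg.mcrit k + reg.a k * m fl / reg.Zm k))).re ∂(wilsonMeasure (fundamentalRep (Fin 3)) (reg.β k))) = (∫ (U : GaugeConfig 4 (2 * S + 1) SU3), h U * (Real.exp (-(reg.β k * wilsonAction (fundamentalRep (Fin 3)) U)) * (∏ fl : Fin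 Nf, fermionDet (Literature.MathematicalPhysics.QuantumLattice.wilsonDiracAP U (reg.mcrit k + reg.a k * m fl / reg.Zm k))).re) ∂(Measure.pi fun _ : Edge 4 (2 * S + 1) => haarProbability SU3)) / ∫ (U : GaugeConfig 4 (2 * S + 1) SU3), Real.exp (-(reg.β k * wilsonAction (fundamentalRep (Fin 3)) U)) * (∏ fl : Fin Nf, fermionDet (Literature.MathematicalPhysics.QuantumLattice.wilsonDiracAP U (reg.mcrit k + reg.a k * m fl / reg.Zm k))).re ∂(Measure.pi fun _ : Edge 4 (2 * S + 1) => haarProbability SU3) := by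
  intro Nf reg m k S h
  rw [haarRatio_integral_div_integral_wilsonMeasure (fundamentalRep (Fin 3))
    (continuous_fundamentalRep (Fin 3))]
  simp only [mul_left_comm (Real.exp _) (h _)]

end Summit.QuantumFields.QCD.Cruxes.ExtinctionBuildsQCD.BlockAwayTheSign

end
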